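import Literature.Geometry.Lorentzian.KerrNullShearFree
import Literature.Geometry.Lorentzian.KerrConformalWave
import Literature.Geometry.Lorentzian.KerrNullFrameFlux
import HarnessLib

/-!
# Pointwise coercivity of the `p = 1` and `p = 2` Dafermos–Rodnianski bulk terms in the far region
# of Kerr (radiation-field form)

(family `gr`; infrastructure for the far-region `r^p`-weighted estimates behind statement **gr.S24**
— the named fact `Kerr.dafermosRodnianski_pHierarchy_scri` of `KerrDecayHierarchy.lean`;
namespace `Literature.Geometry.Lorentzian.Kerr`)

For the radiation field `Ψ = rψ` of a solution of the wave equation on Kerr, the divergence of the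
current `J̃^X[Ψ]` of the multiplier `X = f(r) m` for the conformal coefficient field `r⁻² g⁻¹`
(`KerrConformalWave.lean`) is, pointwise,
`∑_μ ∂_μ (J̃^X)^μ = 𝒱 Ψ · f u + K̃^{fm}` (`KerrSchild.sum_fderiv_multiplierCurrent` with
`□_{r⁻²g⁻¹}Ψ = 𝒱Ψ`, `Kerr.waveOperator_confInverseMetric_radius_mul_eq_of_wave`; `u = dΨ(m)`), and by
`Kerr.multiplierBulk_confInverseMetric_radial_smul_outVector`, `Kerr.multiplierBulk_radial_smul_outVector`
and `Kerr.multiplierBulk_outVector_shearFree`,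
`r² K̃^{fm} = ½ f′ u² + c_A |p̸|² + (1 − 2H) f (r/Σ − 1/r) u v + f′ u (p̸·∇̸r) + 2 f v (p̸·∇̸H)`,
`c_A = f ∂_{ℓ♯}H − ½(1 − 2H) f′ + (1 − 2H) f/r` (`Kerr.sq_mul_multiplierBulk_confInverseMetric_eq`).
This file turns the identity into the two **pointwise lower bounds** that drive the `p = 1` and
`p = 2` estimates of Dafermos–Rodnianski (arXiv:0910.4957, §3–§4: bulk `½ r^{p−1}(p (∂_vΨ)² +
(2 − p)|∇̸Ψ|²)`; Moschidis arXiv:1509.08489, Thm. 5.1 with its error terms), for `M ≥ 0` and all real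
`a`, at points of the far region `r ≥ R₀(M, a)`:

* `Kerr.rpOne_coercivity` (**`p = 1`, `f = r`**): for `r ≥ 16M`, `r ≥ 4|a|`, `r > 0`,
  `⅛ u² + ⅛ |p̸|² ≤ r² (K̃^{r m} + 𝒱 Ψ r u) + (2a⁴ + 208 M²a²) r⁻⁴ v² + 8 (M + |a|)² r⁻⁴ Ψ²`;
* `Kerr.rpTwo_coercivity` (**`p = 2`, `f = r² + C₁ r`**, `C₁ = 8M + 32a² + 32M|a| + 4`): for
  `r ≥ C₁ + 16M + 4|a|`,
  `(r/2) u² + |p̸|² ≤ r² (K̃^{fm} + 𝒱 Ψ f u) + (a² + 11 M|a|) r^{-3/2} v² + 16 (M + |a|)² r⁻³ Ψ²`.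

Here `u = dΨ(m)`, `v = dΨ(k)`, `|p̸|²` are the frame functionals of `KerrNullFrame.lean` at the
point. The left-hand sides are the signed bulk densities of (p-WE): for `p = 1` both the outgoing and
the angular derivatives with weight `r⁰ = r^{p−1}`, for `p = 2` the outgoing derivative with weight
`r = r^{p−1}` (the `(2 − p)|∇̸Ψ|²` term being absent, the admixture `C₁ r` of the `p = 1` multiplier
supplies the angular control that absorbs the `O(M)|p̸|²` curvature term `f ∂_{ℓ♯}H ≈ −M`). The
right-hand sides carry the two kinds of error of the method on Kerr, with their **weights**: a
transversal term `v² = (kΨ)²` with weight `r⁻⁴` (`p = 1`) resp. `r^{-3/2}` (`p = 2`) — in terms of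
`ψ` (`kΨ = r kψ − ψ`) of weight at most `r^{-3/2+2-2} = r^{-3/2}` relative to `dt* dy`, below the
`r^{-1-δ}` of the far-region Morawetz estimate (`KerrLargeRCurrent.lean`) — and a zeroth-order term
from the potential `𝒱 = 2(Mr − a²)/(r⁴Σ)` of the radiation-field equation, of weight `r⁻⁴` resp.
`r⁻³` in `Ψ²` (Hardy). There is **no `v²` term of weight `r^{p−2}`**: this is the content of the
exact null frame (`KerrRpBulk.lean`).

Ingredients proved here: `|∇̸H|² ≤ 26 M²a²/r⁶` (from `dH = (M/Σ²)((Σ − 4r²)dr + 2r y⃗·dy⃗)`,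
`Kerr.fderiv_scalarH_apply`, `Kerr.posCovector`), `|𝒱| ≤ 2(Mr + a²)/(r⁴Σ)`; the elementary algebra
(Cauchy–Schwarz for the angular pairing, weighted means) and the bounds `r² ≤ Σ ≤ 2r²`,
`|∂_{ℓ♯}H| ≤ M/r²`, `|∇̸r|² ≤ a²/r²` are those of `KerrNullFrameFlux.lean`. No named facts (D-0026).

## References

* M. Dafermos, I. Rodnianski, arXiv:0910.4957, §3 (p-WE-Mink), §4 (p-WE-Schw), and the remark that
  the hierarchy is stable under perturbation (key `DafermosRodnianski2010ICMP`).
* G. Moschidis, arXiv:1509.08489 = Ann. PDE 2 (2016), Thm. 5.1, Lemma 4.1 (the transversal terms are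
  controlled by the `∂_r`-Morawetz estimate) (key `Moschidis2016`).
* M. Dafermos, I. Rodnianski, Y. Shlapentokh-Rothman, arXiv:1402.7034, §3.3 (key
  `DafermosRodnianskiShlapentokhrothman2014`).
-/

noncomputable section

open Set Filter
open scoped Topology

namespace Literature.Geometry.Lorentzian.Kerr

variable {M a : ℝ} {x : E4}

/-- **The directional derivative of `H`**: `dH(v) = M (dr(v) Σ − r (4r dr(v) − 2 x⃗·v⃗))/Σ²`
(`H = Mr/Σ`, `Σ = 2r² − |x⃗|² + a²` near the point; quotient rule along `t ↦ x + tv`).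
[cite: arXiv07060622, (33)] -/
theorem fderiv_scalarH_apply (M : ℝ) (hx : 0 < radius a x) (v : E4) :
    fderiv ℝ (scalarH M a) x v =
      M * (fderiv ℝ (radius a) x v * blSigma a (E4.spatial x) -
        radius a x * (4 * radius a x * fderiv ℝ (radius a) x v -
          2 * (x 1 * v 1 + x 2 * v 2 + x 3 * v 3))) / blSigma a (E4.spatial x) ^ 2 := by
  have hS := blSigma_spatial_pos hx
  have hd : DifferentiableAt ℝ (scalarH M a) x := (contDiffAt_scalarH M a hx (n := 1)).differentiableAt one_ne_zero
  have h1 : HasLineDerivAt ℝ (scalarH M a) (fderiv ℝ (scalarH M a) x v) x v := hd.hasFDerivAt.hasLineDerivAt _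
  refine h1.unique ?_
  show HasDerivAt (fun t : ℝ ↦ scalarH M a (x + t • v)) _ 0
  have hr := hasDerivAt_radius_line hx v
  -- `Σ` along the line
  have hSfun : ∀ t : ℝ, blSigma a (E4.spatial (x + t • v)) =
      2 * radius a (x + t • v) ^ 2 - ((x 1 + t * v 1) ^ 2 + (x 2 + t * v 2) ^ 2 + (x 3 + t * v 3) ^ 2) + a ^ 2 := by
    intro t
    rw [blSigma_spatial_eq, E4.spatialNorm_sq]
    simp
  have hSd : HasDerivAt (fun t : ℝ ↦ blSigma a (E4.spatial (x + t • v)))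
      (2 * (↑(2 : ℕ) * radius a (x + (0 : ℝ) • v) ^ (2 - 1) * fderiv ℝ (radius a) x v) -
        (↑(2 : ℕ) * (x 1 + 0 * v 1) ^ (2 - 1) * v 1 + ↑(2 : ℕ) * (x 2 + 0 * v 2) ^ (2 - 1) * v 2 +
          ↑(2 : ℕ) * (x 3 + 0 * v 3) ^ (2 - 1) * v 3)) 0 := by
    have hl : ∀ i : Fin 4, HasDerivAt (fun t : ℝ ↦ x i + t * v i) (v i) 0 := fun i ↦ by
      simpa using ((hasDerivAt_id (0 : ℝ)).mul_const (v i)).const_add (x i)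
    have h := (((hr.pow 2).const_mul 2).sub (((hl 1).pow 2).add (((hl 2).pow 2)) |>.add ((hl 3).pow 2))).add_const (a ^ 2)
    refine (h.congr_of_eventuallyEq (Eventually.of_forall fun t ↦ hSfun t)).congr_deriv ?_
    ring
  have hev : (fun t : ℝ ↦ scalarH M a (x + t • v)) =ᶠ[𝓝 0]
      fun t ↦ M * radius a (x + t • v) / blSigma a (E4.spatial (x + t • v)) := by
    have hcont : ContinuousAt (fun t : ℝ ↦ radius a (x + t • v)) 0 := hr.continuousAt
    have hpos : ∀ᶠ t : ℝ in 𝓝 0, 0 < radius a (x + t • v) :=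
      hcont.eventually (lt_mem_nhds (by simpa using hx))
    filter_upwards [hpos] with t ht
    exact scalarH_eq_div_blSigma M a ht
  have hdiv := (hr.const_mul M).div hSd (by simpa using hS.ne')
  refine (hdiv.congr_of_eventuallyEq hev).congr_deriv ?_
  simp only [zero_smul, add_zero, Nat.cast_ofNat, zero_mul, pow_one, Nat.add_one_sub_one]
  field_simp
  ring

/-- The spatial position covector `Y = (0, x₁, x₂, x₃)` (so that `Y(v) = x⃗·v⃗`). [folklore] -/
def posCovector (x : E4) (μ : Fin 4) : ℝ := if μ = 0 then 0 else x μ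

/-- `ℓ⃗·x⃗ = r`: the null component of the position covector. [cite: arXiv07060622, (34)–(35)] -/
theorem spatialDotNull_posCovector (hx : 0 < radius a x) : spatialDotNull a x (posCovector x) = radius a x := by
  rw [spatialDotNull_eq]
  simp only [posCovector, Fin.isValue, one_ne_zero, if_false, show (2 : Fin 4) ≠ 0 from by decide,
    show (3 : Fin 4) ≠ 0 from by decide]
  have h := sum_coord_mul_nullCovectorFun hx
  linarith [h]

/-- **`|x̸⃗|² = |x⃗|² − r² = a² − a²z²/r² ≤ a²`**: the angular part of the position covector.
[cite: arXiv07060622, (35)] -/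
theorem frameAngSq_posCovector_le (hx : 0 < radius a x) : frameAngSq a x (posCovector x) ≤ a ^ 2 := by
  rw [frameAngSq, spatialDotNull_posCovector hx, Fin.sum_univ_three]
  simp only [posCovector, Fin.succ_zero_eq_one, Fin.succ_one_eq_two, fin_succ_two_eq_three, Fin.isValue,
    one_ne_zero, if_false, show (2 : Fin 4) ≠ 0 from by decide, show (3 : Fin 4) ≠ 0 from by decide]
  have h1 := blSigma_spatial_eq a x
  rw [E4.spatialNorm_sq] at h1
  have h2 := blSigma_spatial_eq_sq_add (a := a) hx
  have h3 : 0 ≤ a ^ 2 * x 3 ^ 2 / radius a x ^ 2 := by positivity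
  linarith

/-- **`dH = (M/Σ²)((Σ − 4r²) dr + 2r Y)`** componentwise (`Y = posCovector`). [cite: arXiv07060622, (33)] -/
theorem fderiv_scalarH_basisVector_eq (M : ℝ) (hx : 0 < radius a x) (μ : Fin 4) :
    fderiv ℝ (scalarH M a) x (E4.basisVector μ) =
      M * (blSigma a (E4.spatial x) - 4 * radius a x ^ 2) / blSigma a (E4.spatial x) ^ 2 *
          fderiv ℝ (radius a) x (E4.basisVector μ) +
        2 * M * radius a x / blSigma a (E4.spatial x) ^ 2 * posCovector x μ := by
  rw [fderiv_scalarH_apply M hx]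
  have hY : x 1 * E4.basisVector μ 1 + x 2 * E4.basisVector μ 2 + x 3 * E4.basisVector μ 3 = posCovector x μ := by
    fin_cases μ <;> simp [posCovector, E4.basisVector]
  rw [hY]
  have hS := (blSigma_spatial_pos hx).ne'
  field_simp
  ring

/-- **`|∇̸H|² ≤ 26 M² a²/r⁶`** for `r ≥ |a|` (`|Σ − 4r²| ≤ 3r²`, `|∇̸r|² ≤ a²/r²`, `|Y̸|² ≤ a²`,
`Σ ≥ r²`). [folklore] -/
theorem frameAngSq_fderiv_scalarH_le (hx : 0 < radius a x) (ha : |a| ≤ radius a x) :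
    frameAngSq a x (fun μ ↦ fderiv ℝ (scalarH M a) x (E4.basisVector μ)) ≤ 26 * M ^ 2 * a ^ 2 / radius a x ^ 6 := by
  have hr := hx
  have hS := blSigma_spatial_pos hx
  have h1 := sq_le_blSigma_spatial (a := a) hx
  have h2 := blSigma_spatial_le_two_mul_sq hx ha
  set α := M * (blSigma a (E4.spatial x) - 4 * radius a x ^ 2) / blSigma a (E4.spatial x) ^ 2 with hα
  set β := 2 * M * radius a x / blSigma a (E4.spatial x) ^ 2 with hβ
  have hrepr : (fun μ ↦ fderiv ℝ (scalarH M a) x (E4.basisVector μ)) =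
      fun μ ↦ α * fderiv ℝ (radius a) x (E4.basisVector μ) + β * posCovector x μ := by
    funext μ; exact fderiv_scalarH_basisVector_eq M hx μ
  rw [hrepr]
  have hq := frameAngSq_lincomb_le hx (fun μ ↦ fderiv ℝ (radius a) x (E4.basisVector μ)) (posCovector x) α β
  have hdr := frameAngSq_fderiv_radius_le M hx
  have hY := frameAngSq_posCovector_le (a := a) hx
  have hdr0 := frameAngSq_nonneg hx (fun μ ↦ fderiv ℝ (radius a) x (E4.basisVector μ))
  have hY0 := frameAngSq_nonneg hx (posCovector x)
  -- bounds for `α²`, `β²`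
  have hα2 : α ^ 2 ≤ 9 * M ^ 2 / radius a x ^ 4 := by
    rw [hα, div_pow, div_le_div_iff₀ (by positivity) (by positivity)]
    have h3 : (blSigma a (E4.spatial x) - 4 * radius a x ^ 2) ^ 2 ≤ 9 * (radius a x ^ 2) ^ 2 := by
      nlinarith
    calc (M * (blSigma a (E4.spatial x) - 4 * radius a x ^ 2)) ^ 2 * radius a x ^ 4
        = M ^ 2 * ((blSigma a (E4.spatial x) - 4 * radius a x ^ 2) ^ 2 * radius a x ^ 4) := by ring
      _ ≤ M ^ 2 * (9 * (radius a x ^ 2) ^ 2 * (radius a x ^ 2) ^ 2) := by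
          refine mul_le_mul_of_nonneg_left ?_ (sq_nonneg M)
          calc _ ≤ 9 * (radius a x ^ 2) ^ 2 * radius a x ^ 4 :=
                mul_le_mul_of_nonneg_right h3 (by positivity)
            _ = 9 * (radius a x ^ 2) ^ 2 * (radius a x ^ 2) ^ 2 := by ring
      _ ≤ M ^ 2 * (9 * (blSigma a (E4.spatial x) ^ 2) ^ 2) := by
          refine mul_le_mul_of_nonneg_left ?_ (sq_nonneg M)
          have : (radius a x ^ 2) ^ 2 ≤ blSigma a (E4.spatial x) ^ 2 := pow_le_pow_left₀ (sq_nonneg _) h1 2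
          nlinarith [this, sq_nonneg (blSigma a (E4.spatial x))]
      _ = 9 * M ^ 2 * (blSigma a (E4.spatial x) ^ 2) ^ 2 := by ring
  have hβ2 : β ^ 2 ≤ 4 * M ^ 2 / radius a x ^ 6 := by
    rw [hβ, div_pow, div_le_div_iff₀ (by positivity) (by positivity)]
    have : radius a x ^ 2 * radius a x ^ 6 ≤ (blSigma a (E4.spatial x) ^ 2) ^ 2 := by
      calc radius a x ^ 2 * radius a x ^ 6 = (radius a x ^ 2) ^ 4 := by ring
        _ ≤ blSigma a (E4.spatial x) ^ 4 := pow_le_pow_left₀ (sq_nonneg _) h1 4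
        _ = (blSigma a (E4.spatial x) ^ 2) ^ 2 := by ring
    calc (2 * M * radius a x) ^ 2 * radius a x ^ 6 = 4 * M ^ 2 * (radius a x ^ 2 * radius a x ^ 6) := by ring
      _ ≤ 4 * M ^ 2 * (blSigma a (E4.spatial x) ^ 2) ^ 2 := mul_le_mul_of_nonneg_left this (by positivity)
  calc _ ≤ 2 * α ^ 2 * frameAngSq a x (fun μ ↦ fderiv ℝ (radius a) x (E4.basisVector μ)) +
        2 * β ^ 2 * frameAngSq a x (posCovector x) := hq
    _ ≤ 2 * (9 * M ^ 2 / radius a x ^ 4) * (a ^ 2 / radius a x ^ 2) + 2 * (4 * M ^ 2 / radius a x ^ 6) * a ^ 2 := by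
        gcongr
    _ = 26 * M ^ 2 * a ^ 2 / radius a x ^ 6 := by
        field_simp
        ring

/-- **`|𝒱| ≤ 2(Mr + a²)/(r⁴ Σ) ≤ 2(Mr + a²)/r⁶`** for `M ≥ 0`. [folklore] -/
theorem abs_confPotential_le (hM : 0 ≤ M) (hx : 0 < radius a x) :
    |confPotential M a x| ≤ 2 * (M * radius a x + a ^ 2) / radius a x ^ 6 := by
  have hS := blSigma_spatial_pos hx
  have h1 := sq_le_blSigma_spatial (a := a) hx
  rw [confPotential, abs_div, abs_of_pos (by positivity : (0 : ℝ) < radius a x ^ 4 * blSigma a (E4.spatial x)),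
    div_le_div_iff₀ (by positivity) (by positivity)]
  have h2 : |2 * (M * radius a x - a ^ 2)| ≤ 2 * (M * radius a x + a ^ 2) := by
    rw [abs_le]; constructor <;> nlinarith [mul_nonneg hM hx.le, sq_nonneg a]
  calc |2 * (M * radius a x - a ^ 2)| * radius a x ^ 6 ≤ 2 * (M * radius a x + a ^ 2) * radius a x ^ 6 :=
        mul_le_mul_of_nonneg_right h2 (by positivity)
    _ = 2 * (M * radius a x + a ^ 2) * (radius a x ^ 4 * radius a x ^ 2) := by ring
    _ ≤ 2 * (M * radius a x + a ^ 2) * (radius a x ^ 4 * blSigma a (E4.spatial x)) := by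
        gcongr

/-! ### The `r²`-rescaled bulk in the frame -/

/-- **`r² K̃^{fm}` in the null frame.** For a profile `f` differentiable at `r(x)`, with `p = dw`,
`u = p(m)`, `v = p(k)`, `|p̸|²`, `B_r = p̸·∇̸r`, `B_H = p̸·∇̸H`, `H_ℓ = ∂_{ℓ♯}H`:
`r² K^{fm}[r⁻²g⁻¹] = ½ f′ u² + (f H_ℓ − ½(1 − 2H) f′ + (1 − 2H) f/r)|p̸|²
  + (1 − 2H) f (r/Σ − 1/r) u v + f′ u B_r + 2 f v B_H`. [cite: DafermosRodnianski2010ICMP, §3–§4] -/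
theorem sq_mul_multiplierBulk_confInverseMetric_eq (M a : ℝ) (hx : 0 < radius a x) {f : ℝ → ℝ}
    (hf : DifferentiableAt ℝ f (radius a x)) (w : E4 → ℝ) :
    radius a x ^ 2 *
        KerrSchild.multiplierBulk (confInverseMetric M a) (fun y μ ↦ f (radius a y) * outVector M a y μ) w x =
      2⁻¹ * deriv f (radius a x) * frameOut M a x (fun μ ↦ fderiv ℝ w x (E4.basisVector μ)) ^ 2 +
        (f (radius a x) * fderiv ℝ (scalarH M a) x (nullVector a x) -
            2⁻¹ * (1 - 2 * scalarH M a x) * deriv f (radius a x) +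
            (1 - 2 * scalarH M a x) * f (radius a x) / radius a x) *
          frameAngSq a x (fun μ ↦ fderiv ℝ w x (E4.basisVector μ)) +
        (1 - 2 * scalarH M a x) * f (radius a x) * (radius a x / blSigma a (E4.spatial x) - (radius a x)⁻¹) *
          (frameOut M a x (fun μ ↦ fderiv ℝ w x (E4.basisVector μ)) *
            frameIn a x (fun μ ↦ fderiv ℝ w x (E4.basisVector μ))) +
        deriv f (radius a x) * frameOut M a x (fun μ ↦ fderiv ℝ w x (E4.basisVector μ)) *
          frameAng a x (fun μ ↦ fderiv ℝ w x (E4.basisVector μ))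
            (fun μ ↦ fderiv ℝ (radius a) x (E4.basisVector μ)) +
        2 * f (radius a x) * frameIn a x (fun μ ↦ fderiv ℝ w x (E4.basisVector μ)) *
          frameAng a x (fun μ ↦ fderiv ℝ w x (E4.basisVector μ))
            (fun μ ↦ fderiv ℝ (scalarH M a) x (E4.basisVector μ)) := by
  have hr : radius a x ≠ 0 := hx.ne'
  rw [multiplierBulk_confInverseMetric_radial_smul_outVector M a hx, multiplierBulk_radial_smul_outVector M a hx hf,
    multiplierBulk_outVector_shearFree M hx, sum_inverseMetric_mul_mul_self_eq_frame]
  field_simp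
  ring

/-! ### The `p = 1` estimate -/

/-- **Pointwise coercivity of the `p = 1` bulk (`f = r`) in the far region of Kerr.** Let `M ≥ 0`,
and `x` a point with `r = r(x) > 0`, `r ≥ 16M`, `r ≥ 4|a|`. For every `Ψ : E4 → ℝ`, with `p = dΨ(x)`,
`u = p(m)`, `v = p(k)`, `|p̸|²` the frame functionals and
`D = 𝒱 Ψ(x) · (r u) + K^{r m}[r⁻²g⁻¹](x)` the space-time density of the `p = 1` current of the
radiation-field equation (`∑_μ ∂_μ (J̃^{rm})^μ = D` where `□_{r⁻²g⁻¹}Ψ = 𝒱Ψ`),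
`⅛ u² + ⅛ |p̸|² ≤ r² D + (2a⁴ + 208 M²a²) r⁻⁴ v² + 8 (M + |a|)² r⁻⁴ Ψ(x)²`.
This is the `p = 1` member `½(∂_vΨ)² + ½|∇̸Ψ|²` of (p-WE), with the two Kerr error terms (transversal,
weight `r⁻⁴`; zeroth order from the potential, weight `r⁻⁴`). [cite: DafermosRodnianski2010ICMP, §3–§4] -/
theorem rpOne_coercivity (hM : 0 ≤ M) (hx : 0 < radius a x) (hrM : 16 * M ≤ radius a x)
    (hra : 4 * |a| ≤ radius a x) (Ψ : E4 → ℝ) :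
    8⁻¹ * frameOut M a x (fun μ ↦ fderiv ℝ Ψ x (E4.basisVector μ)) ^ 2 +
        8⁻¹ * frameAngSq a x (fun μ ↦ fderiv ℝ Ψ x (E4.basisVector μ)) ≤
      radius a x ^ 2 *
          (confPotential M a x * Ψ x * (radius a x * frameOut M a x (fun μ ↦ fderiv ℝ Ψ x (E4.basisVector μ))) +
            KerrSchild.multiplierBulk (confInverseMetric M a) (fun y μ ↦ radius a y * outVector M a y μ) Ψ x) +
        (2 * a ^ 4 + 208 * M ^ 2 * a ^ 2) / radius a x ^ 4 *
          frameIn a x (fun μ ↦ fderiv ℝ Ψ x (E4.basisVector μ)) ^ 2 +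
        8 * (M + |a|) ^ 2 / radius a x ^ 4 * Ψ x ^ 2 := by
  -- the identity for `f = id`
  have hid := sq_mul_multiplierBulk_confInverseMetric_eq M a hx (f := fun s ↦ s) differentiableAt_id Ψ
  have hd1 : deriv (fun s : ℝ ↦ s) (radius a x) = 1 := deriv_id (radius a x)
  rw [hd1] at hid
  beta_reduce at hid
  rw [mul_add, hid]
  clear hid hd1
  -- names
  set r := radius a x with hr_def
  set S := blSigma a (E4.spatial x) with hS_def
  set H := scalarH M a x with hH_def
  set Hl := fderiv ℝ (scalarH M a) x (nullVector a x) with hHl_def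
  set p : Fin 4 → ℝ := fun μ ↦ fderiv ℝ Ψ x (E4.basisVector μ) with hp
  set u := frameOut M a x p with hu
  set v := frameIn a x p with hv
  set A := frameAngSq a x p with hA
  set Br := frameAng a x p (fun μ ↦ fderiv ℝ (radius a) x (E4.basisVector μ)) with hBr
  set BH := frameAng a x p (fun μ ↦ fderiv ℝ (scalarH M a) x (E4.basisVector μ)) with hBH
  set V := confPotential M a x with hV
  have hr0 : 0 < r := hx
  have ha : |a| ≤ r := by linarith [abs_nonneg a]
  have hS0 : 0 < S := blSigma_spatial_pos hx
  have hSr : r ^ 2 ≤ S := sq_le_blSigma_spatial hx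
  have hH0 : 0 ≤ H := scalarH_nonneg hM a x
  have hHM : H ≤ M / r := scalarH_le_div hM a hx
  have hHl : |Hl| ≤ M / r ^ 2 := abs_fderiv_scalarH_nullVector_le hM hx ha
  have hA0 : 0 ≤ A := frameAngSq_nonneg hx p
  have hBr2 : Br ^ 2 ≤ A * (a ^ 2 / r ^ 2) :=
    (frameAng_sq_le hx p _).trans (mul_le_mul_of_nonneg_left (frameAngSq_fderiv_radius_le M hx) hA0)
  have hBH2 : BH ^ 2 ≤ A * (26 * M ^ 2 * a ^ 2 / r ^ 6) :=
    (frameAng_sq_le hx p _).trans (mul_le_mul_of_nonneg_left (frameAngSq_fderiv_scalarH_le hx ha) hA0)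
  have hVb : |V| ≤ 2 * (M * r + a ^ 2) / r ^ 6 := abs_confPotential_le hM hx
  -- the one-dimensional quantities
  have hMr : M / r ≤ 16⁻¹ := by rw [div_le_iff₀ hr0]; linarith
  have ha2r : a ^ 2 / r ^ 2 ≤ 16⁻¹ := by
    rw [div_le_iff₀ (by positivity)]
    have : (4 * |a|) ^ 2 ≤ r ^ 2 := pow_le_pow_left₀ (by positivity) hra 2
    nlinarith [sq_abs a]
  -- (1) the `|p̸|²` coefficient is `≥ ½(1 − 2H) + r Hl ≥ ½ − 2M/r`
  have hcA : 2⁻¹ - 2 * (M / r) ≤ r * Hl - 2⁻¹ * (1 - 2 * H) * 1 + (1 - 2 * H) * r / r := by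
    rw [mul_div_assoc, div_self hr0.ne', mul_one]
    have h1 : -(M / r) ≤ r * Hl := by
      have h3 : r * (-(M / r ^ 2)) ≤ r * Hl := mul_le_mul_of_nonneg_left (by linarith [neg_abs_le Hl]) hr0.le
      calc -(M / r) = r * (-(M / r ^ 2)) := by field_simp
        _ ≤ r * Hl := h3
    linarith
  have hcAA : (2⁻¹ - 2 * (M / r)) * A ≤ (r * Hl - 2⁻¹ * (1 - 2 * H) * 1 + (1 - 2 * H) * r / r) * A :=
    mul_le_mul_of_nonneg_right hcA hA0
  -- (2) the `u v` term: `|(1 − 2H) r (r/S − 1/r) u v| ≤ (a²/r²)|u||v| ≤ ⅛u² + 2a⁴r⁻⁴v²`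
  have huv : |(1 - 2 * H) * r * (r / S - r⁻¹) * (u * v)| ≤ 8⁻¹ * u ^ 2 + 2 * a ^ 4 / r ^ 4 * v ^ 2 := by
    have hc : (1 - 2 * H) * r * (r / S - r⁻¹) = (1 - 2 * H) * ((r ^ 2 - S) / S) := by
      field_simp
    have hfrac : |(r ^ 2 - S) / S| ≤ a ^ 2 / r ^ 2 := by
      rw [abs_div, abs_of_pos hS0, div_le_div_iff₀ hS0 (by positivity)]
      have hSeq : S = r ^ 2 + a ^ 2 * x 3 ^ 2 / r ^ 2 := blSigma_spatial_eq_sq_add hx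
      have hz : x 3 ^ 2 ≤ r ^ 2 := sq_apply_three_le_sq hx
      have habs : |r ^ 2 - S| = a ^ 2 * x 3 ^ 2 / r ^ 2 := by
        rw [hSeq, abs_of_nonpos (by
          have : 0 ≤ a ^ 2 * x 3 ^ 2 / r ^ 2 := by positivity
          linarith)]
        ring
      rw [habs]
      have h5 : a ^ 2 * x 3 ^ 2 / r ^ 2 * r ^ 2 = a ^ 2 * x 3 ^ 2 := by field_simp
      rw [h5]
      calc a ^ 2 * x 3 ^ 2 ≤ a ^ 2 * r ^ 2 := mul_le_mul_of_nonneg_left hz (sq_nonneg a)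
        _ ≤ a ^ 2 * S := mul_le_mul_of_nonneg_left hSr (sq_nonneg a)
    have hcoef : |(1 - 2 * H) * r * (r / S - r⁻¹)| ≤ a ^ 2 / r ^ 2 := by
      rw [hc, abs_mul, abs_of_nonneg (by linarith : 0 ≤ 1 - 2 * H)]
      calc (1 - 2 * H) * |(r ^ 2 - S) / S| ≤ 1 * (a ^ 2 / r ^ 2) :=
            mul_le_mul (by linarith) hfrac (abs_nonneg _) zero_le_one
        _ = a ^ 2 / r ^ 2 := one_mul _
    have hsplit : a ^ 2 / r ^ 2 * (|u| * |v|) ≤ 8⁻¹ * u ^ 2 + 2 * a ^ 4 / r ^ 4 * v ^ 2 := by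
      have h := two_mul_le_of_one_le_mul (α := 4⁻¹) (β := 4) (X := |u|) (Y := a ^ 2 / r ^ 2 * |v|)
        (by norm_num) (by norm_num)
      rw [sq_abs, mul_pow, sq_abs] at h
      have e1 : a ^ 2 / r ^ 2 * (|u| * |v|) = 2⁻¹ * (2 * |u| * (a ^ 2 / r ^ 2 * |v|)) := by ring
      have e2 : 4 * ((a ^ 2 / r ^ 2) ^ 2 * v ^ 2) = 2 * (2 * a ^ 4 / r ^ 4 * v ^ 2) := by field_simp; ring
      have h' : 2 * |u| * (a ^ 2 / r ^ 2 * |v|) ≤ 4⁻¹ * u ^ 2 + 2 * (2 * a ^ 4 / r ^ 4 * v ^ 2) := by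
        rw [← e2]; exact h
      rw [e1]; linarith [h']
    calc _ = |(1 - 2 * H) * r * (r / S - r⁻¹)| * (|u| * |v|) := by rw [abs_mul, abs_mul u v]
      _ ≤ a ^ 2 / r ^ 2 * (|u| * |v|) := mul_le_mul_of_nonneg_right hcoef (by positivity)
      _ ≤ _ := hsplit
  -- (3) the `u B_r` term: `|u B_r| ≤ ⅛u² + 2(a²/r²) A`
  have huBr : |1 * u * Br| ≤ 8⁻¹ * u ^ 2 + 2 * (a ^ 2 / r ^ 2) * A := by
    have key : (1 * u * Br) ^ 2 ≤ (8⁻¹ * u ^ 2 + 2 * (a ^ 2 / r ^ 2) * A) ^ 2 := by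
      have h1 : (1 * u * Br) ^ 2 = u ^ 2 * Br ^ 2 := by ring
      have h2 : u ^ 2 * Br ^ 2 ≤ u ^ 2 * (A * (a ^ 2 / r ^ 2)) := mul_le_mul_of_nonneg_left hBr2 (sq_nonneg u)
      have h3 : u ^ 2 * (A * (a ^ 2 / r ^ 2)) = 4 * (8⁻¹ * u ^ 2) * (2 * (a ^ 2 / r ^ 2) * A) := by ring
      rw [h1]
      exact (h2.trans_eq h3).trans (four_mul_le_sq_add _ _)
    exact abs_le_of_sq_le_sq key (by positivity)
  -- (4) the `v B_H` term: `|2 r v B_H| ≤ ⅛ A + 208 M²a² r⁻⁴ v²`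
  have hvBH : |2 * r * v * BH| ≤ 8⁻¹ * A + 208 * M ^ 2 * a ^ 2 / r ^ 4 * v ^ 2 := by
    have key : (2 * r * v * BH) ^ 2 ≤ (8⁻¹ * A + 208 * M ^ 2 * a ^ 2 / r ^ 4 * v ^ 2) ^ 2 := by
      have h1 : (2 * r * v * BH) ^ 2 = 4 * r ^ 2 * v ^ 2 * BH ^ 2 := by ring
      have h2 : 4 * r ^ 2 * v ^ 2 * BH ^ 2 ≤ 4 * r ^ 2 * v ^ 2 * (A * (26 * M ^ 2 * a ^ 2 / r ^ 6)) :=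
        mul_le_mul_of_nonneg_left hBH2 (by positivity)
      have h3 : 4 * r ^ 2 * v ^ 2 * (A * (26 * M ^ 2 * a ^ 2 / r ^ 6)) =
          4 * (8⁻¹ * A) * (208 * M ^ 2 * a ^ 2 / r ^ 4 * v ^ 2) := by
        field_simp; ring
      rw [h1]
      exact (h2.trans_eq h3).trans (four_mul_le_sq_add _ _)
    exact abs_le_of_sq_le_sq key (by positivity)
  -- (5) the potential term: `|r² 𝒱 Ψ r u| ≤ ⅛u² + 8(M + |a|)² r⁻⁴ Ψ²`
  have hpot : |r ^ 2 * (V * Ψ x * (r * u))| ≤ 8⁻¹ * u ^ 2 + 8 * (M + |a|) ^ 2 / r ^ 4 * Ψ x ^ 2 := by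
    have hV3 : |r ^ 3 * V| ≤ 2 * (M + |a|) / r ^ 2 := by
      rw [abs_mul, abs_of_pos (by positivity : (0 : ℝ) < r ^ 3)]
      have haa : a ^ 2 ≤ |a| * r := by
        calc a ^ 2 = |a| * |a| := by rw [← sq_abs]; ring
          _ ≤ |a| * r := mul_le_mul_of_nonneg_left ha (abs_nonneg a)
      calc r ^ 3 * |V| ≤ r ^ 3 * (2 * (M * r + a ^ 2) / r ^ 6) := mul_le_mul_of_nonneg_left hVb (by positivity)
        _ ≤ r ^ 3 * (2 * (M * r + |a| * r) / r ^ 6) := by gcongr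
        _ = 2 * (M + |a|) / r ^ 2 := by field_simp
    have key : (r ^ 2 * (V * Ψ x * (r * u))) ^ 2 ≤ (8⁻¹ * u ^ 2 + 8 * (M + |a|) ^ 2 / r ^ 4 * Ψ x ^ 2) ^ 2 := by
      have h1 : (r ^ 2 * (V * Ψ x * (r * u))) ^ 2 = (r ^ 3 * V) ^ 2 * (Ψ x ^ 2 * u ^ 2) := by ring
      have h2 : (r ^ 3 * V) ^ 2 ≤ (2 * (M + |a|) / r ^ 2) ^ 2 := by
        rw [← sq_abs (r ^ 3 * V)]
        exact pow_le_pow_left₀ (abs_nonneg _) hV3 2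
      have h3 : (r ^ 3 * V) ^ 2 * (Ψ x ^ 2 * u ^ 2) ≤ (2 * (M + |a|) / r ^ 2) ^ 2 * (Ψ x ^ 2 * u ^ 2) :=
        mul_le_mul_of_nonneg_right h2 (by positivity)
      have h4 : (2 * (M + |a|) / r ^ 2) ^ 2 * (Ψ x ^ 2 * u ^ 2) =
          4 * (8⁻¹ * u ^ 2) * (8 * (M + |a|) ^ 2 / r ^ 4 * Ψ x ^ 2) := by
        field_simp; ring
      rw [h1]
      exact (h3.trans_eq h4).trans (four_mul_le_sq_add _ _)
    exact abs_le_of_sq_le_sq key (by positivity)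
  -- assemble (linear)
  have e1 := neg_abs_le ((1 - 2 * H) * r * (r / S - r⁻¹) * (u * v))
  have e2 := neg_abs_le (1 * u * Br)
  have e3 := neg_abs_le (2 * r * v * BH)
  have e4 := neg_abs_le (r ^ 2 * (V * Ψ x * (r * u)))
  have hfin : 0 ≤ (4⁻¹ - 2 * (M / r) - 2 * (a ^ 2 / r ^ 2)) * A :=
    mul_nonneg (by linarith) hA0
  have hE : (2 * a ^ 4 + 208 * M ^ 2 * a ^ 2) / r ^ 4 * v ^ 2 =
      2 * a ^ 4 / r ^ 4 * v ^ 2 + 208 * M ^ 2 * a ^ 2 / r ^ 4 * v ^ 2 := by ring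
  rw [hE]
  linarith [hcAA, huv, huBr, hvBH, hpot, e1, e2, e3, e4, hfin, hA0]

/-! ### The `p = 2` estimate -/

/-- The admixture constant `C₁ = 8M + 32a² + 32M|a| + 4` of the `p = 1` multiplier in the `p = 2`
multiplier `f = r² + C₁ r` (it absorbs the curvature term `f ∂_{ℓ♯}H ≈ −M` and the angular errors).
[cite: DafermosRodnianski2010ICMP, §4] -/
def rpTwoConst (M a : ℝ) : ℝ := 8 * M + 32 * a ^ 2 + 32 * M * |a| + 4

set_option maxHeartbeats 800000 in
/-- **Pointwise coercivity of the `p = 2` bulk (`f = r² + C₁ r`) in the far region of Kerr.** Let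
`M ≥ 0`, `C₁ = rpTwoConst M a`, and `x` a point with `r = r(x) ≥ C₁ + 16M + 4|a|`. For every
`Ψ : E4 → ℝ`, with the notation of `Kerr.rpOne_coercivity` and
`D = 𝒱 Ψ(x) · (f(r) u) + K^{f m}[r⁻²g⁻¹](x)`, `f(r) = r² + C₁ r`,
`(r/2) u² + |p̸|² ≤ r² D + (a² + 11 M|a|) (r√r)⁻¹ v² + 16 (M + |a|)² r⁻³ Ψ(x)²`.
This is the `p = 2` member `r (∂_vΨ)²` of (p-WE) (plus the angular control of the admixed `p = 1`
multiplier), with the transversal error of weight `r^{-3/2}` and the zeroth-order error of weight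
`r⁻³`. [cite: DafermosRodnianski2010ICMP, §3–§4] -/
theorem rpTwo_coercivity (hM : 0 ≤ M) (hx : 0 < radius a x)
    (hR : rpTwoConst M a + 16 * M + 4 * |a| ≤ radius a x) (Ψ : E4 → ℝ) :
    radius a x / 2 * frameOut M a x (fun μ ↦ fderiv ℝ Ψ x (E4.basisVector μ)) ^ 2 +
        frameAngSq a x (fun μ ↦ fderiv ℝ Ψ x (E4.basisVector μ)) ≤
      radius a x ^ 2 *
          (confPotential M a x * Ψ x *
              ((radius a x ^ 2 + rpTwoConst M a * radius a x) *
                frameOut M a x (fun μ ↦ fderiv ℝ Ψ x (E4.basisVector μ))) +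
            KerrSchild.multiplierBulk (confInverseMetric M a)
              (fun y μ ↦ (radius a y ^ 2 + rpTwoConst M a * radius a y) * outVector M a y μ) Ψ x) +
        (a ^ 2 + 11 * M * |a|) / (radius a x * Real.sqrt (radius a x)) *
          frameIn a x (fun μ ↦ fderiv ℝ Ψ x (E4.basisVector μ)) ^ 2 +
        16 * (M + |a|) ^ 2 / radius a x ^ 3 * Ψ x ^ 2 := by
  -- the identity for `f(s) = s² + C₁ s`
  have hfd : HasDerivAt (fun s : ℝ ↦ s ^ 2 + rpTwoConst M a * s) (2 * radius a x + rpTwoConst M a) (radius a x) := by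
    have h := (hasDerivAt_pow 2 (radius a x)).add ((hasDerivAt_id (radius a x)).const_mul (rpTwoConst M a))
    refine h.congr_deriv ?_
    simp only [Nat.cast_ofNat, Nat.add_one_sub_one, pow_one, mul_one]
  have hid := sq_mul_multiplierBulk_confInverseMetric_eq M a hx (f := fun s ↦ s ^ 2 + rpTwoConst M a * s)
    hfd.differentiableAt Ψ
  rw [hfd.deriv] at hid
  beta_reduce at hid
  rw [mul_add, hid]
  -- names
  set C₁ := rpTwoConst M a with hC₁
  set r := radius a x with hr_def
  set S := blSigma a (E4.spatial x) with hS_def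
  set H := scalarH M a x with hH_def
  set Hl := fderiv ℝ (scalarH M a) x (nullVector a x) with hHl_def
  set p : Fin 4 → ℝ := fun μ ↦ fderiv ℝ Ψ x (E4.basisVector μ) with hp
  set u := frameOut M a x p with hu
  set v := frameIn a x p with hv
  set A := frameAngSq a x p with hA
  set Br := frameAng a x p (fun μ ↦ fderiv ℝ (radius a) x (E4.basisVector μ)) with hBr
  set BH := frameAng a x p (fun μ ↦ fderiv ℝ (scalarH M a) x (E4.basisVector μ)) with hBH
  set V := confPotential M a x with hV
  set s := Real.sqrt r with hs_def
  -- scalar facts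
  have hC : C₁ = 8 * M + 32 * a ^ 2 + 32 * M * |a| + 4 := by rw [hC₁, rpTwoConst]
  have hMa : 0 ≤ M * |a| := mul_nonneg hM (abs_nonneg a)
  have hC₁4 : 4 ≤ C₁ := by rw [hC]; nlinarith [sq_nonneg a]
  have hC₁a : 32 * a ^ 2 ≤ C₁ := by rw [hC]; nlinarith
  have hC₁r : C₁ ≤ r := by linarith [abs_nonneg a]
  have hrM : 16 * M ≤ r := by linarith [abs_nonneg a]
  have hra : 4 * |a| ≤ r := by linarith
  have hr1 : 1 ≤ r := by linarith
  have hr0 : 0 < r := hx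
  have ha : |a| ≤ r := by linarith [abs_nonneg a]
  have hs0 : 0 < s := Real.sqrt_pos.2 hr0
  have hss : s ^ 2 = r := Real.sq_sqrt hr0.le
  have hs1 : 1 ≤ s := by rw [hs_def]; exact Real.one_le_sqrt.2 hr1
  have hS0 : 0 < S := blSigma_spatial_pos hx
  have hSr : r ^ 2 ≤ S := sq_le_blSigma_spatial hx
  have hH0 : 0 ≤ H := scalarH_nonneg hM a x
  have hHM : H ≤ M / r := scalarH_le_div hM a hx
  have hHl : |Hl| ≤ M / r ^ 2 := abs_fderiv_scalarH_nullVector_le hM hx ha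
  have hA0 : 0 ≤ A := frameAngSq_nonneg hx p
  have hBr2 : Br ^ 2 ≤ A * (a ^ 2 / r ^ 2) :=
    (frameAng_sq_le hx p _).trans (mul_le_mul_of_nonneg_left (frameAngSq_fderiv_radius_le M hx) hA0)
  have hBH2 : BH ^ 2 ≤ A * (26 * M ^ 2 * a ^ 2 / r ^ 6) :=
    (frameAng_sq_le hx p _).trans (mul_le_mul_of_nonneg_left (frameAngSq_fderiv_scalarH_le hx ha) hA0)
  have hVb : |V| ≤ 2 * (M * r + a ^ 2) / r ^ 6 := abs_confPotential_le hM hx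
  have hMr : M / r ≤ 16⁻¹ := by rw [div_le_iff₀ hr0]; linarith
  have hf2 : r ^ 2 + C₁ * r ≤ 2 * r ^ 2 := by nlinarith
  have hf0 : 0 ≤ r ^ 2 + C₁ * r := by positivity
  -- normal form of the bulk
  have hid' : 2⁻¹ * (2 * r + C₁) * u ^ 2 +
        ((r ^ 2 + C₁ * r) * Hl - 2⁻¹ * (1 - 2 * H) * (2 * r + C₁) + (1 - 2 * H) * (r ^ 2 + C₁ * r) / r) * A +
        (1 - 2 * H) * (r ^ 2 + C₁ * r) * (r / S - r⁻¹) * (u * v) + (2 * r + C₁) * u * Br +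
        2 * (r ^ 2 + C₁ * r) * v * BH =
      (r + C₁ / 2) * u ^ 2 + ((r ^ 2 + C₁ * r) * Hl + (1 - 2 * H) * C₁ / 2) * A +
        (1 - 2 * H) * (r ^ 2 + C₁ * r) * (r / S - r⁻¹) * (u * v) + (2 * r + C₁) * u * Br +
        2 * (r ^ 2 + C₁ * r) * v * BH := by
    field_simp
    ring
  rw [hid']
  clear hid hid' hfd
  -- (1) the `|p̸|²` coefficient: `≥ C₁/2 − 3M`
  have hcA : C₁ / 2 - 3 * M ≤ (r ^ 2 + C₁ * r) * Hl + (1 - 2 * H) * C₁ / 2 := by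
    have h1 : -(M / r ^ 2) ≤ Hl := by linarith [neg_abs_le Hl]
    have h2 : (r ^ 2 + C₁ * r) * (-(M / r ^ 2)) ≤ (r ^ 2 + C₁ * r) * Hl := mul_le_mul_of_nonneg_left h1 hf0
    have h3 : (r ^ 2 + C₁ * r) * (-(M / r ^ 2)) = -M - C₁ * (M / r) := by
      field_simp
      ring
    have h4 : C₁ * (M / r) ≤ M := by
      calc C₁ * (M / r) ≤ r * (M / r) := mul_le_mul_of_nonneg_right hC₁r (by positivity)
        _ = M / r * r := mul_comm _ _
        _ = M := div_mul_cancel₀ M hr0.ne'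
    have h5 : H * C₁ ≤ M := by
      calc H * C₁ ≤ (M / r) * C₁ := mul_le_mul_of_nonneg_right hHM (by linarith)
        _ = C₁ * (M / r) := by ring
        _ ≤ M := h4
    linarith [h2, h3, h4, h5]
  have hcAA : (C₁ / 2 - 3 * M) * A ≤ ((r ^ 2 + C₁ * r) * Hl + (1 - 2 * H) * C₁ / 2) * A :=
    mul_le_mul_of_nonneg_right hcA hA0
  -- (2) the `u v` term: `≤ a²/s u² + a²/(r s) v²`
  have huv : |(1 - 2 * H) * (r ^ 2 + C₁ * r) * (r / S - r⁻¹) * (u * v)| ≤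
      a ^ 2 / s * u ^ 2 + a ^ 2 / (r * s) * v ^ 2 := by
    have hfrac : |r / S - r⁻¹| ≤ a ^ 2 / r ^ 3 := by
      have hc : r / S - r⁻¹ = (r ^ 2 - S) / (r * S) := by field_simp
      rw [hc, abs_div, abs_of_pos (by positivity : 0 < r * S), div_le_div_iff₀ (by positivity) (by positivity)]
      have hSeq : S = r ^ 2 + a ^ 2 * x 3 ^ 2 / r ^ 2 := blSigma_spatial_eq_sq_add hx
      have hz : x 3 ^ 2 ≤ r ^ 2 := sq_apply_three_le_sq hx
      have habs : |r ^ 2 - S| = a ^ 2 * x 3 ^ 2 / r ^ 2 := by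
        rw [hSeq, abs_of_nonpos (by
          have : 0 ≤ a ^ 2 * x 3 ^ 2 / r ^ 2 := by positivity
          linarith)]
        ring
      rw [habs]
      have h5 : a ^ 2 * x 3 ^ 2 / r ^ 2 * r ^ 3 = a ^ 2 * x 3 ^ 2 * r := by field_simp
      rw [h5]
      calc a ^ 2 * x 3 ^ 2 * r ≤ a ^ 2 * r ^ 2 * r := by gcongr
        _ = a ^ 2 * (r * r ^ 2) := by ring
        _ ≤ a ^ 2 * (r * S) := by gcongr
    have hcoef : |(1 - 2 * H) * (r ^ 2 + C₁ * r) * (r / S - r⁻¹)| ≤ 2 * a ^ 2 / r := by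
      rw [abs_mul, abs_mul, abs_of_nonneg (by linarith : 0 ≤ 1 - 2 * H), abs_of_nonneg hf0]
      have h12 : (1 - 2 * H) * (r ^ 2 + C₁ * r) ≤ 1 * (2 * r ^ 2) :=
        mul_le_mul (by linarith) hf2 hf0 zero_le_one
      calc (1 - 2 * H) * (r ^ 2 + C₁ * r) * |r / S - r⁻¹| ≤ 1 * (2 * r ^ 2) * (a ^ 2 / r ^ 3) :=
            mul_le_mul h12 hfrac (abs_nonneg _) (by positivity)
        _ = 2 * a ^ 2 / r := by field_simp
    have key : ((1 - 2 * H) * (r ^ 2 + C₁ * r) * (r / S - r⁻¹) * (u * v)) ^ 2 ≤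
        (a ^ 2 / s * u ^ 2 + a ^ 2 / (r * s) * v ^ 2) ^ 2 := by
      have h1 : ((1 - 2 * H) * (r ^ 2 + C₁ * r) * (r / S - r⁻¹) * (u * v)) ^ 2 =
          ((1 - 2 * H) * (r ^ 2 + C₁ * r) * (r / S - r⁻¹)) ^ 2 * (u ^ 2 * v ^ 2) := by ring
      have h2 : ((1 - 2 * H) * (r ^ 2 + C₁ * r) * (r / S - r⁻¹)) ^ 2 ≤ (2 * a ^ 2 / r) ^ 2 := by
        rw [← sq_abs ((1 - 2 * H) * (r ^ 2 + C₁ * r) * (r / S - r⁻¹))]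
        exact pow_le_pow_left₀ (abs_nonneg _) hcoef 2
      have h3 := mul_le_mul_of_nonneg_right h2 (by positivity : 0 ≤ u ^ 2 * v ^ 2)
      have h4 : (2 * a ^ 2 / r) ^ 2 * (u ^ 2 * v ^ 2) = 4 * (a ^ 2 / s * u ^ 2) * (a ^ 2 / (r * s) * v ^ 2) := by
        have hr' : r = s ^ 2 := hss.symm
        rw [hr']
        field_simp
        ring
      rw [h1]
      exact (h3.trans_eq h4).trans (four_mul_le_sq_add _ _)
    exact abs_le_of_sq_le_sq key (by positivity)
  -- (3) the `u B_r` term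
  have huBr : |(2 * r + C₁) * u * Br| ≤ r / 4 * u ^ 2 + 9 * a ^ 2 / r * A := by
    have key : ((2 * r + C₁) * u * Br) ^ 2 ≤ (r / 4 * u ^ 2 + 9 * a ^ 2 / r * A) ^ 2 := by
      have h1 : ((2 * r + C₁) * u * Br) ^ 2 = (2 * r + C₁) ^ 2 * u ^ 2 * Br ^ 2 := by ring
      have h2 : (2 * r + C₁) ^ 2 * u ^ 2 * Br ^ 2 ≤ (3 * r) ^ 2 * u ^ 2 * (A * (a ^ 2 / r ^ 2)) := by
        have h21 : (2 * r + C₁) ^ 2 ≤ (3 * r) ^ 2 := pow_le_pow_left₀ (by positivity) (by linarith) 2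
        calc _ ≤ (3 * r) ^ 2 * u ^ 2 * Br ^ 2 := by gcongr
          _ ≤ _ := mul_le_mul_of_nonneg_left hBr2 (by positivity)
      have h3 : (3 * r) ^ 2 * u ^ 2 * (A * (a ^ 2 / r ^ 2)) = 4 * (r / 4 * u ^ 2) * (9 * a ^ 2 / r * A) := by
        field_simp
        ring
      rw [h1]
      exact (h2.trans_eq h3).trans (four_mul_le_sq_add _ _)
    exact abs_le_of_sq_le_sq key (by positivity)
  -- (4) the `v B_H` term
  have hvBH : |2 * (r ^ 2 + C₁ * r) * v * BH| ≤ 11 * M * |a| / s * A + 11 * M * |a| / (r * s) * v ^ 2 := by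
    have key : (2 * (r ^ 2 + C₁ * r) * v * BH) ^ 2 ≤ (11 * M * |a| / s * A + 11 * M * |a| / (r * s) * v ^ 2) ^ 2 := by
      have h1 : (2 * (r ^ 2 + C₁ * r) * v * BH) ^ 2 = 4 * (r ^ 2 + C₁ * r) ^ 2 * v ^ 2 * BH ^ 2 := by ring
      have h2 : 4 * (r ^ 2 + C₁ * r) ^ 2 * v ^ 2 * BH ^ 2 ≤
          4 * (2 * r ^ 2) ^ 2 * v ^ 2 * (A * (26 * M ^ 2 * a ^ 2 / r ^ 6)) := by
        have h21 : (r ^ 2 + C₁ * r) ^ 2 ≤ (2 * r ^ 2) ^ 2 := pow_le_pow_left₀ hf0 hf2 2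
        calc _ ≤ 4 * (2 * r ^ 2) ^ 2 * v ^ 2 * BH ^ 2 := by gcongr
          _ ≤ _ := mul_le_mul_of_nonneg_left hBH2 (by positivity)
      have h3 : 4 * (2 * r ^ 2) ^ 2 * v ^ 2 * (A * (26 * M ^ 2 * a ^ 2 / r ^ 6)) ≤
          4 * (11 * M * |a| / s * A) * (11 * M * |a| / (r * s) * v ^ 2) := by
        have e : 4 * (11 * M * |a| / s * A) * (11 * M * |a| / (r * s) * v ^ 2) =
            484 * (M ^ 2 * a ^ 2 / r ^ 2 * (A * v ^ 2)) := by
          have hr' : r = s ^ 2 := hss.symm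
          rw [hr']
          field_simp
          rw [sq_abs]
          ring
        have e' : 4 * (2 * r ^ 2) ^ 2 * v ^ 2 * (A * (26 * M ^ 2 * a ^ 2 / r ^ 6)) =
            416 * (M ^ 2 * a ^ 2 / r ^ 2 * (A * v ^ 2)) := by
          field_simp
          ring
        rw [e, e']
        have : 0 ≤ M ^ 2 * a ^ 2 / r ^ 2 * (A * v ^ 2) := by positivity
        nlinarith [this]
      rw [h1]
      exact (h2.trans h3).trans (four_mul_le_sq_add _ _)
    exact abs_le_of_sq_le_sq key (by positivity)
  -- (5) the potential term
  have hpot : |r ^ 2 * (V * Ψ x * ((r ^ 2 + C₁ * r) * u))| ≤ r / 4 * u ^ 2 + 16 * (M + |a|) ^ 2 / r ^ 3 * Ψ x ^ 2 := by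
    have hV4 : |r ^ 4 * V| ≤ 2 * (M + |a|) / r := by
      rw [abs_mul, abs_of_pos (by positivity : (0 : ℝ) < r ^ 4)]
      have haa : a ^ 2 ≤ |a| * r := by
        calc a ^ 2 = |a| * |a| := by rw [← sq_abs]; ring
          _ ≤ |a| * r := mul_le_mul_of_nonneg_left ha (abs_nonneg a)
      calc r ^ 4 * |V| ≤ r ^ 4 * (2 * (M * r + a ^ 2) / r ^ 6) := mul_le_mul_of_nonneg_left hVb (by positivity)
        _ ≤ r ^ 4 * (2 * (M * r + |a| * r) / r ^ 6) := by gcongr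
        _ = 2 * (M + |a|) / r := by field_simp
    have hg0 : 0 ≤ (r ^ 2 + C₁ * r) / r ^ 2 := by positivity
    have hg2 : (r ^ 2 + C₁ * r) / r ^ 2 ≤ 2 := by
      rw [div_le_iff₀ (by positivity)]; linarith [hf2]
    have hT : r ^ 2 * (V * Ψ x * ((r ^ 2 + C₁ * r) * u)) =
        (r ^ 4 * V) * ((r ^ 2 + C₁ * r) / r ^ 2) * (Ψ x * u) := by
      field_simp
    have key : ((r ^ 4 * V) * ((r ^ 2 + C₁ * r) / r ^ 2) * (Ψ x * u)) ^ 2 ≤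
        (r / 4 * u ^ 2 + 16 * (M + |a|) ^ 2 / r ^ 3 * Ψ x ^ 2) ^ 2 := by
      have h1 : ((r ^ 4 * V) * ((r ^ 2 + C₁ * r) / r ^ 2) * (Ψ x * u)) ^ 2 =
          (r ^ 4 * V) ^ 2 * ((r ^ 2 + C₁ * r) / r ^ 2) ^ 2 * (Ψ x ^ 2 * u ^ 2) := by ring
      have h21 : (r ^ 4 * V) ^ 2 ≤ (2 * (M + |a|) / r) ^ 2 := by
        rw [← sq_abs (r ^ 4 * V)]; exact pow_le_pow_left₀ (abs_nonneg _) hV4 2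
      have h22 : ((r ^ 2 + C₁ * r) / r ^ 2) ^ 2 ≤ 2 ^ 2 := pow_le_pow_left₀ hg0 hg2 2
      have h2 : (r ^ 4 * V) ^ 2 * ((r ^ 2 + C₁ * r) / r ^ 2) ^ 2 * (Ψ x ^ 2 * u ^ 2) ≤
          (2 * (M + |a|) / r) ^ 2 * 2 ^ 2 * (Ψ x ^ 2 * u ^ 2) :=
        mul_le_mul_of_nonneg_right (mul_le_mul h21 h22 (sq_nonneg _) (sq_nonneg _)) (by positivity)
      have h3 : (2 * (M + |a|) / r) ^ 2 * 2 ^ 2 * (Ψ x ^ 2 * u ^ 2) =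
          4 * (r / 4 * u ^ 2) * (16 * (M + |a|) ^ 2 / r ^ 3 * Ψ x ^ 2) := by
        field_simp
        ring
      rw [h1]
      exact (h2.trans_eq h3).trans (four_mul_le_sq_add _ _)
    rw [hT]
    exact abs_le_of_sq_le_sq key (by positivity)
  -- assemble (linear)
  have e1 := neg_abs_le ((1 - 2 * H) * (r ^ 2 + C₁ * r) * (r / S - r⁻¹) * (u * v))
  have e2 := neg_abs_le ((2 * r + C₁) * u * Br)
  have e3 := neg_abs_le (2 * (r ^ 2 + C₁ * r) * v * BH)
  have e4 := neg_abs_le (r ^ 2 * (V * Ψ x * ((r ^ 2 + C₁ * r) * u)))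
  have hU : 0 ≤ (C₁ / 2 - a ^ 2 / s) * u ^ 2 := by
    refine mul_nonneg ?_ (sq_nonneg u)
    have : a ^ 2 / s ≤ a ^ 2 := by
      rw [div_le_iff₀ hs0]
      exact le_mul_of_one_le_right (sq_nonneg a) hs1
    linarith only [this, hC₁a, sq_nonneg a]
  have hAA : 0 ≤ (C₁ / 2 - 3 * M - 9 * a ^ 2 / r - 11 * M * |a| / s - 1) * A := by
    refine mul_nonneg ?_ hA0
    have h9 : 9 * a ^ 2 / r ≤ 9 * a ^ 2 := by
      rw [div_le_iff₀ hr0]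
      exact le_mul_of_one_le_right (by positivity) hr1
    have h11 : 11 * M * |a| / s ≤ 11 * M * |a| := by
      rw [div_le_iff₀ hs0]
      exact le_mul_of_one_le_right (by positivity) hs1
    linarith only [h9, h11, hC, hMa, hM, sq_nonneg a]
  have hE : (a ^ 2 + 11 * M * |a|) / (r * s) * v ^ 2 =
      a ^ 2 / (r * s) * v ^ 2 + 11 * M * |a| / (r * s) * v ^ 2 := by ring
  rw [hE]
  linarith only [hcAA, huv, huBr, hvBH, hpot, e1, e2, e3, e4, hU, hAA, hA0]

end Literature.Geometry.Lorentzian.Kerr
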